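import Mathlib
import HarnessLib
import HarnessLib.Audit
import Summits.Langlands.Statement
import HarnessLib.Audit.Check
import Literature.NumberTheory.Automorphic.GLnAdelicStructureProofs
import Literature.FieldTheory.AlgClosed.PadicAlgClEquivComplex
import Literature.NumberTheory.Automorphic.LocalLanglandsGLProofs
import Literature.NumberTheory.Automorphic.LocalConstantsProofs
import HarnessLib.Audit.Status.Attr

/-!
Route: DedekindQuotient1951

# Route DedekindQuotient1951 — certified zero ledger for zeta_K/zeta of the Doud-Moore quintic can
refute typed reciprocity at n = 4 (typed Langlands proves Dedekind's conjecture for the even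
icosahedral field)

NEGATION LENS / operator D (computational witness), refutation shape (closes : C1 → C2 → C3 → S4 →
¬Langlands). Let K be the totally real A₅
quintic field of the Doud–Moore polynomial x⁵ − x⁴ − 780x³ + 9911x² − 24208x + 15952 (discriminant
1951⁴; its two even icosahedral lifts are the
conductor-1951 representations of QuarterDeficit1951; the field, its Galois permutation datum e₀ :
Γ_ℚ → S₅ and its ramification are LANDED:
Theorems/QuarterDeficit1951IcosahedralSupply{StubDmGaloisDatum,DoudMooreField,Away}). The
4-dimensional constituent ρ₄ of the permutation
representation on the five roots is an IRREDUCIBLE Artin representation (the 4-dim irrep of A₅ = ρ ⊗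
ρ' of the two 2-dim icosahedral lifts) with
L(s, ρ₄) = ζ_K(s)/ζ(s), unramified away from 1951. Typed conjunct (B) at F = ℚ, n = 4 applied to its
ℓ-adic avatar gives a CUSPIDAL L-algebraic π
on GL₄(𝔸_ℚ) with `Corresponds` at every finite place; typed local–global compatibility at the
unramified places reads the Satake parameters off the
Frobenius characteristic polynomials (tree, all n), and Godement–Jacquet (partial standard
L-functions of cuspidal π are entire, support S4) then
gives (C2) an entire continuation of ∏_{p∉T} ζ_{K,p}/ζ_p, hence ζ_K/ζ holomorphic on Re s > 0:
DEDEKIND'S CONJECTURE for K, which is OPEN exactly here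
(ζ_K/ζ_k entire is known for K/k normal (Aramata–Brauer) and for solvable normal closure (Uchida,
van der Waall 1975); for an A₅ quintic that is
not totally real it follows from modularity of the odd 2-dim lifts (Khare–Wintenberger) and
Ramakrishnan's GL₂×GL₂ → GL₄; the totally real A₅
case is the even icosahedral blind spot). X (the bet, C1) = for the field K, ζ_K/ζ is NOT
holomorphic on the box 0 < Re s, |Im s| < 100 — a
statement Booker's almost-monomial criterion (A₅ is almost monomial, Booker2006 Prop. 3) plus
Arb-certified evaluations of ζ_K, L(s,χ₃,K) (= L(ρ₅))
and L(s,χ₂,K₆) (= L(ρ₃)L(ρ₃')) at the 29 zeros of ζ below height 100 settles EITHER way (pole ⇔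
ζ_K(ρ_ζ) ≠ 0 at a zero ρ_ζ of ζ; absence of hidden
poles ⇔ non-vanishing of the two auxiliary Hecke L-functions on small discs around each ρ_ζ). X ∧ C2
∧ C3 ∧ S4 → ¬Langlands. No idea card is realised.
Lean: `QuinticDedekindPole ∧ DedekindQuotientEntire ∧ DoudMoorePermutationSupply ∧ PartialLEntire`

## Assembly
Pure logic, refutation shape (sorry-free in Sketch.lean; glue.lean `closes : QuinticDedekindPole →
DedekindQuotientEntire → DoudMoorePermutationSupply →
PartialLEntire → ¬Langlands`): assume Langlands; specialise to F = ℚ and obtain RD;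
DoudMoorePermutationSupply at ℓ = 7 gives ρ, the field K = ℚ(θ)
and the Frobenius data; conjunct (B) at n = 4 (hcpt := isCompact_glFiniteIntegralLevel_holds 4 ℚ, ι
from PadicAlgCl.nonempty_ringEquiv_complex 7)
gives a cuspidal L-algebraic π with Corresponds RD ι π ρ; DedekindQuotientEntire (fed
PartialLEntire) gives g holomorphic on Re s > 0 with g·ζ = ζ_K on
Re s > 1; restricting g to the box contradicts QuinticDedekindPole. All four hypotheses are
load-bearing.

Rationale: WHY THIS LINE. The typed summit is Hodge–Tate-blind (the recipe at ∞ is omitted), so a (B)-deficit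
census can be closed into ¬Langlands only where every competing
archimedean type of the correspondent is excluded by a THEOREM — which, after QuarterDeficit1951
took the GL₂/ℚ Maass slot, leaves no decidable
spectral window (GL₃/ℚ and mixed-signature fields leak through Artin-type principal series; abelian
surfaces need GSp₄ infrastructure and are being
overtaken by BCGP). HOLOMORPHY OF L-FUNCTIONS is the one consequence of typed (B) that needs NO
archimedean pinning: Godement–Jacquet is ∞-type
free, and typed local–global compatibility fixes every unramified Euler factor. Pointing it at the
irreducible 4-dimensional Artin representation
of the minimal even icosahedral field turns typed reciprocity at n = 4 into Dedekind's 1900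
conjecture for one explicit quintic, and Booker's 2006
criterion (arXiv:math/0507502 §2, Prop. 3: A₅ almost monomial; §6: S₅ signature-(3,1) example to
height 100 — "totally real A₅ fields … the smallest
known discriminant is far too large to test") makes the finite-height statement decidable both ways
by certified zero ledgers of Dedekind/Hecke
L-functions (degree ≤ 6, conductor 1951⁴ ≈ 1.45·10¹³: ≈ 10³ core-hours, vs ≈ 10³ core-days for the
trace-formula census). Imported: analytic theory
of Artin/Hecke L-functions (Brauer1947, Booker2003, Booker2006, FooteMurty
doi:10.1017/s0305004100001316), Godement–Jacquet/Jacquet–Shalika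
(GodementJacquet1972, JacquetShalikaAJM1981; the tree's AutomorphicLFunction /
GodementJacquetPartialL), Dedekind's Frobenius–splitting theorem
(NeukirchANT1999 I §8–9), the landed Doud–Moore field (DoudMoore2006). What no prior route does: a
certified L-FUNCTION ZERO computation as the
deciding instrument, an instance of (B) at n = 4 (ρ ⊗ ρ'), and a formal chain "typed reciprocity ⇒
Dedekind's conjecture" (SteinbergArtinDedekind
treats ζ_K/ζ for Borel-type fields of ODD residual representations by p-adic lifting;
QuarterDeficit1951 counts Maass forms at n = 2).

RANKED CRUXES. #2 QuinticDedekindPole (crux) — [computational bet] for every number field K = ℚ(θ)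
generated by a root θ of x⁵ − x⁴ − 780x³ + 9911x² − 24208x + 15952 (the Doud–Moore totally real A₅
quintic, d_K = 1951⁴), the quotient ζ_K/ζ is NOT holomorphic on the box 0 < Re s, |Im s| < 100:
there is no function g holomorphic on that box with g(s)·ζ(s) = ζ_K(s) for Re s > 1, |Im s| < 100.
Settled by ONE kit job: Arb-certified evaluation (smoothed approximate functional equation,
Booker2006 §5 / Turing §4) of ζ_K (degree 5, N = 1951⁴), L(s,χ₃,K) = L(ρ₅) (degree 5, N = 1951⁴) and
L(s,χ₂,K₆) = L(ρ₃)L(ρ₃') (degree 6, N = 1951⁴) on small discs around the 29 zeros of ζ with 0 < Im <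
100; TRUE-certificate = a zero ρ_ζ with |ζ_K(ρ_ζ)| > error (pole of ζ_K/ζ) ⇒ with C2, C3, S4:
¬Langlands; FALSE-certificate = at every such disc the two auxiliary Hecke L-functions do not vanish
(Booker's almost-monomial consistency for A₅: then ord L(ρ₄) ≥ 0 pointwise) ⇒ route closes
refuted:QuinticDedekindPole with the first certified verification of Artin/Dedekind holomorphy for a
totally real A₅ field as evidence. [difficulty: L] (why it might fail: Langlands (indeed Artin) is
true: ζ_K(ρ_ζ) = 0 exactly at every zero of ζ and the two auxiliary L-functions are generically
non-zero there, so the certified ledger refutes C1 (the non-rigorous PARI value at the first zeros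
is the cheapest indication).) [Booker2006, Booker2003, DoudMoore2006, arXiv:1610.01228,
zbl:0298.12003, zbl:1044.11099]
#3 DedekindQuotientEntire (crux) — [typed reciprocity ⇒ Dedekind's conjecture] Given the
Godement–Jacquet input S4 (as antecedent): for every number field K, reciprocity datum RD of ℚ,
prime ℓ, ι : ℚ̄_ℓ ≃ ℂ, cuspidal L-algebraic π of GL₄(𝔸_ℚ) and ρ : Γ_ℚ → GL₄(ℚ̄_ℓ) such that at every
finite v with N v ∉ {1951, ℓ} ρ is unramified with Frobenius characteristic polynomial Q_v
satisfying (X − 1)·Q_v = ∏_{𝔭 ∣ N v} (X^{f(𝔭)} − 1) in 𝓞_K, if `Corresponds RD ι π ρ` (the summit's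
predicate: Satake matching a.e. AND local–global compatibility at every finite place) then ζ_K/ζ is
holomorphic on Re s > 0: there is g holomorphic there with g·ζ = ζ_K on Re s > 1. Chain: the
COFINITE Satake–Frobenius clause of `Corresponds` alone (no local Langlands property needed;
alternatively LGC at unramified v ∤ ℓ, landed for all n as
satakeFrobCompatibleAt_of_localGlobalCompatibleAt_away) + uniqueness of Frobenius characteristic
polynomials at unramified places ⇒ off a FINITE set T ⊇ {v : N v ∈ {1951, ℓ}} the Satake Euler
polynomial at v is Q_v (root multiset stable under inversion, so the arithmetic/geometric Frobenius
dictionary is immaterial); S4 at n = 4 with S = T gives an entire g₀ equal to ∏_{p∉T} ζ_{K,p}(s)(1 −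
p^{-s}) far to the right; g := g₀·∏_{p∈T} ζ_{K,p}(s)(1 − p^{-s}) is holomorphic on Re s > 0 (T
finite, each factor pole-free off Re s = 0) and g·ζ = ζ_K on Re s > 1 by the Euler products of ζ
(Mathlib) and of ζ_K over rational primes and the identity principle (birth skeleton
bc/DedekindQuotientEntire_birth.lean: stub_satakeCofinite, stub_analyticGlue, composition
kernel-checked). [deps: PartialLEntire] [difficulty: L] (why it might fail: as TYPED: the
summit-model π reaches Godement–Jacquet only via the Borel–Jacquet dictionary; a normalisation slip
(q^s-shift of Satake parameters, arithmetic vs geometric Frobenius) would break g·ζ = ζ_K by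
finitely many Euler factors.) [GodementJacquet1972, JacquetShalikaAJM1981,
BorelJacquetCorvallis1979, HarrisTaylorAMS2001, BuzzardGeeLMS2014, NeukirchANT1999]
#9 DoudMoorePermutationSupply (support) — [Doud–Moore permutation supply, known in substance] for
every reciprocity datum RD of ℚ and every prime ℓ ≠ 1951 there are ρ : Γ_ℚ → GL₄(ℚ̄_ℓ) irreducible
and geometric in the summit's sense, and the number field K = ℚ(θ) of a root of the Doud–Moore
quintic (IntermediateField.adjoin ℚ {θ} = ⊤), such that ρ is unramified at every v with N v ≠ 1951
with Frobenius characteristic polynomial Q_v, (X − 1)·Q_v = ∏_{𝔭 ∣ N v} (X^{f(𝔭)} − 1). Witness: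
from the LANDED stub_dmGaloisDatum / doudMooreField (roots θ : Fin 5 → ℤ̄, permutation datum e₀ :
Γ_ℚ → S₅ with open kernel, image A₅ containing a 5-cycle, unramified away from 1951): ρ = the
permutation representation on the roots restricted to the sum-zero hyperplane, ℚ̄_ℓ-coefficients;
irreducible (4-dim irrep of A₅, characteristic 0); geometric via
isGeometricFramed_of_unramified_away (ℓ ≠ 1951: unramified ⇒ de Rham for every datum); the
characteristic-polynomial identity is Dedekind's theorem (cycle type of Frobenius on the roots =
residue degrees of the primes above p in ℚ(θ), p unramified), (X − 1)·charpoly(ρ(Frob)) =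
charpoly(perm(Frob)) = ∏_cycles (X^len − 1). [difficulty: M] [DoudMoore2006, NeukirchANT1999,
JonesRoberts2008]
#9 PartialLEntire (support) — [needs-fact, stated INLINE in the summit's model: Godement–Jacquet +
Jacquet–Shalika + the Borel–Jacquet dictionary] for every n ≥ 2, every cuspidal automorphic
representation π of GL_n(𝔸_ℚ) (CuspidalAutomorphicRepData), every finite set S of finite places and
every family α of Satake parameters of π off S (π.1.HasSatakeParamAt v (α v) for v ∉ S), the partial
standard Euler product ∏_{v∉S} ∏_{a∈α_v} (1 − a·N v^{-s})⁻¹ converges (HasProd) on some right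
half-plane Re s > σ₀ to the values of an ENTIRE function. The day the Literature named fact
`godementJacquet` (n ≥ 2: L(s,Π) entire) is discharged together with the Borel–Jacquet dictionary
facts (exists_isAssociatedL2, hasSatakeParamAt_iff_L2, cuspidal_W'_eq_bot; bridge
CuspidalAutomorphicRepData.exists_satake_eq_cpow_mul_L2 is landed) this item closes in a few lines
(the q^s₀-shift only moves σ₀; the finitely many unramified factors inside S are entire);
Jacquet–Shalika absolute convergence is already unconditional in the tree
(AutomorphicLFunctionHolds). [difficulty: L] [GodementJacquet1972, JacquetShalikaAJM1981,
BorelJacquetCorvallis1979]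

TWO-LAYER PLAN. If C1 is certified TRUE (a pole), DedekindQuotientEntire splits along its birth
skeleton (bc/DedekindQuotientEntire_birth.lean, rc 0): SatakeCofinite
(the cofinite Satake clause of Corresponds + splitting data ⇒ Satake Euler polynomials off a finite
T) → AnalyticGlue (entire partial product + Euler products of ζ, ζ_K + identity
principle ⇒ ζ_K/ζ holomorphic on Re s > 0) → DedekindQuotientEntire (k = 2, depth 1).
DoudMoorePermutationSupply splits as PermutationRep
(ρ₄ from e₀, irreducible, unramified, geometric off 1951) → DedekindFrobeniusOrbits (cycle type =
residue degrees for ℚ(θ)) → DoudMoorePermutationSupply.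
QuinticDedekindPole's skeleton (bc/QuinticDedekindPole_birth.lean, rc 0) is ContinuedNonvanishing
(the certificate in analytic form) + BoxIdentity.

KILL CRITERIA. The ledger job returning, at all 29 zeros of ζ below height 100, certified
non-vanishing of L(s,χ₃,K) and L(s,χ₂,K₆) on the isolating discs (and
ζ_K vanishing to net order ≥ 1) refutes QuinticDedekindPole: close `refuted:QuinticDedekindPole`,
attach the certificate (first certified
Artin/Dedekind holomorphy + RH ledger for a totally real A₅ field, the case Booker2006 could not
reach) and hand DedekindQuotientEntire /
DoudMoorePermutationSupply / PartialLEntire to the even-Artin proof routes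
(EvenArtinQuantumBoundary, HolomorphicShadow, GaloisWeightedBE,
AnalyticDescent) as supports ("typed reciprocity ⇒ Dedekind for K"). A refutation of
DedekindQuotientEntire by an API witness (Satake shift,
model bridge) is a STATEMENT-AUDIT finding on `Corresponds`/`HasSatakeParamAt`, not a pivot: report
needs-human. Strong Artin for the Doud–Moore
ρ (any route, e.g. ParityBlindBianchi / EvenArtinGL4Door) or Ramakrishnan-type automorphy of ρ ⊗ ρ'
makes Dedekind for K a theorem and moots C1.

NOT DECOMPOSED YET. The two pieces of each crux (above) are layer-2 children, filed only if C1 is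
certified true; the certificate format/checker for C1 (Arb transcript:
ball values of the three L-functions on each disc, the zero of ζ isolated by Platt-type rigorous ζ
data, independent re-evaluation) is a
compute-infra request, not an item; no in-kernel checker is claimed (verdict class: computation).
The optional second bet at n = 3 (L(Ad ρ) = L(ρ₃)
has a pole below height 100; decidable by the same ledger since A₅ is almost monomial) is
deliberately NOT an item at open (it needs the tree's
artinLFunction of Ad ρ as an object; it would be a sibling crux consumed disjunctively).

CHEAPEST FALSIFIER. (a) Lookup, run: has Artin/Dedekind holomorphy for the conductor-1951 A₅ field
been certified? Booker2006 p. 8: "totally real A₅ fields … are very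
rare; the smallest known discriminant is far too large to test with current computers" (his numerics
are S₅/odd-A₅); JonesRoberts2017
(arXiv:1610.01228) and the LMFDB Artin pages compute such L-functions numerically ASSUMING Artin;
BLS2020 (arXiv:1803.06016) is the spectral side
and conditional on Artin. No certified ledger found (zbMATH/galaxy searches 2026-08-17;
OpenAlex/S2/arXiv APIs rate-limited, logged).
(b) RAN (kit j022438, non-rigorous PARI, 19 digits, all four sanity gates passed — L(ρ₄,2) = Euler
product to 10⁻¹⁰, L(ρ₄,1) = Res ζ_K =
1.4429767954951727 (h = 30, R = 11442.81, bnfcertify kit j021604) to 16 digits, lfuncheckfeq −50):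
at the FIRST zero ρ₁ = 1/2 + 14.1347i of ζ,
L(ρ₄, ρ₁) = ζ_K/ζ(ρ₁) = 2.923 + 0.257i, |L| = 2.93, with a smooth profile for t ∈ [14.10, 14.17]
(max 2.9465, no spike): ζ_K/ζ is REGULAR there,
ζ_K has a simple zero at ρ₁, and 67 zeros of L(ρ₄) lie on the line in (0, 14.3], none at 14.1347. So
C1 is numerically dead at 1 of the 29 zeros —
the expected picture; what remains is the crux itself: the other 28 zeros, CERTIFIED (Arb), plus the
auxiliary non-vanishing of L(s,χ₃,K) and
L(s,χ₂,K₆) on the isolating discs (evidence CERTIFICATE-SPEC.md / PRECHECK-RESULT.md on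
stmt-Langlands-17270; two earlier PARI runs are VOID,
documented there: a stack overflow left the init variable unbound and gp evaluated ζ instead).

NUMBERS. Field: x⁵ − x⁴ − 780x³ + 9911x² − 24208x + 15952, totally real, Galois group A₅, d_K =
1951⁴ = 14 488 688 572 801 ≈ 1.45·10¹³, 1951 totally
ramified (e = 5, type 3a), unramified elsewhere (DoudMoore2006 §2, §4, Table: six primes p < 10⁴
carry type-3a representations, 1951 minimal; the
search at d = 1951⁴ is exhaustive). A₅ irreps 1, 3, 3', 4, 5; monomial lattice generators
(Booker2006 Prop. 3): 1, ρ₅, 1+ρ₄, ρ₃+ρ₃', ρ₃+ρ₄+ρ₅,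
ρ₃'+ρ₄+ρ₅, ρ₃+ρ₃'+ρ₄; hence with L(ρ₅) = L(s,χ₃,K) and L(ρ₃)L(ρ₃') = L(s,χ₂,K₆) observed
non-vanishing on a disc D around a zero of ζ, pointwise
positivity of the Heilbronn character against the last three generators forces ord L(ρ₄) ≥ 0 on D.
Conductors: ρ₄: 1951⁴ (inertia = regular
representation of C₅ minus 1, no invariants); ρ₅: 1951⁴; ρ₃, ρ₃': 1951² each. Zeros of ζ with 0 < Im
< 100: 29. Approximate-functional-equation
lengths at height 100: degree 5, N = 1951⁴: √Q ≈ 4·10⁹ terms; degree 6: ≈ 1.5·10¹⁰; ≈ 350 certified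
evaluations ⇒ ≈ 10¹⁵ flop + coefficient
sieves to 1.5·10¹⁰ ⇒ ≈ 10³ core-hours (≈ 1 h on the 980-core lane) after ≈ 1–2 weeks of porting
(Booker2006 §5 FFT/AFE in Arb, or Platt's
rigorous framework). Booker2006 §6 precedent: degree 6, N = 3.6·10⁷, height 100, one 3 GHz PC-day
(2005). Items at open: 5 (2 cruxes, 2 supports, 1 assembly).

DEFINITION REQUESTS. compute-infra (to be filed after open): an Arb-certified evaluator of Dedekind
zeta / abelian Hecke L-functions of degree ≤ 6 by the smoothed
approximate functional equation with Booker2006 §5 error terms, emitting ball certificates on discs;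
verdict class `computation` (no kernel checker
claimed). No new Lean notions: NumberField.dedekindZeta, riemannZeta (Mathlib), Ideal.inertiaDeg,
UniqueFactorizationMonoid.factors,
IntermediateField.adjoin, FramedGaloisRep.HasFrobCharpolyAt / IsUnramifiedAt,
CuspidalAutomorphicRepData, HasSatakeParamAt, Corresponds,
IsGeometricFramed all exist; Literature has artinLFunction / LFunction.HasEntireContinuation /
godementJacquet for the layer-2 work.

Novelty: Searches (2026-08-17): `lit search --source zbmath "Dedekind conjecture zeta function quotient
entire"` (5, none relevant) / `"Waall conjecture Dedekind Artin 1975"` (2: zbl:0298.12003 van der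
Waall 1975, zbl:1044.11099 Murty–Raghuram 2000 survey) / `"Turing method Artin conjecture Booker"`
(1: Booker2006, READ in full, arXiv:math/0507502 pp. 3–9, 20–22) / `"even icosahedral Galois
representations prime conductor Doud Moore"` (1: DoudMoore2006, READ pp. 2–7) / `"Jones Roberts
Artin L-functions small conductor"` (1: arXiv:1610.01228) / `"converse theorem GL(3) effective
holomorphy finite height"` (0) / `"Artin L-function first pole height bound effective"` (0); `lit
galaxy search "Dedekind conjecture" --star all` (7: Kaczorowski CIME LNM 1891 Thm 2.5.2–2.5.4 READ
(SOC ⇒ Dedekind, ⇒ Artin), Murty–Esmonde GTM 190 READ (Dedekind known in the solvable tower)); `lit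
read arxiv:1803.06016 --grep 1951|Artin` (BLS2020 §1: Artin table conditional; unconditional
verification "not yet carried out"); `lean search` artinLFunction / dedekindZeta / godementJacquet /
partialStandardL / satakeFrobCompatibleAt_of_localGlobalCompatibleAt_away (all present); all 50 open
Langlands route headers read (lever list in NOTES.md): no route certifies L-function zeros, none
states Dedekind's conjecture, none uses (B) at n = 4. OpenAlex / Semantic Scholar / arXiv APIs were
rate-limited (HTTP 429) during this session — logged; zbMATH and galaxy carried the search.
Nearest prior art found: Booker2006 (arXiv:  [refs: math/0507502, 1610.01228, 1803.06016, arxiv:1803.06016, Booker2006, DoudMoore2006]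

Barriers (technique_class: certified-L-function-zeros, dedekind-conjecture, refutation): - technique_class: certified-L-function-zeros, dedekind-conjecture, refutation
- Literature.Barriers.Langlands.NonRegularWeightBarrier: evaded — nothing p-adic or cohomological is
used; the Hodge–Tate-(0,0,0,0) representation ρ₄ is invisible to cohomology but its L-function ζ_K/ζ
is a ratio of Dedekind zeta functions whose zeros can be certified, and Godement–Jacquet needs no
archimedean type.
- Literature.Barriers.Langlands.SolvableImageBarrier: evaded — no base change or Brauer descent to
solvable pieces is attempted; the insoluble (A₅) obstruction is exactly why Dedekind for K is open,
and the line meets it with a finite certified computation (Booker's positivity uses only that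
MONOMIAL L-functions are entire, a theorem).
- Literature.Barriers.Langlands.ShimuraVarietyRealizationBarrier: not in this technique class (no
Galois representation is constructed from π; the route runs (B) and reads only unramified Euler
factors).
- Literature.Barriers.Langlands.TaylorWilesNumericalCoincidence: not in this technique class (no
patching, no R = T).
- Literature.Barriers.Langlands.TwistedEndoscopySelfDual: not in this technique class (ρ₄ is
orthogonal, but no endoscopic transfer or descent is used — only the standard L-function of GL₄).
- Negatives index: two entries (OrdinaryPrimeTransport.RankinSelbergPoleCount,
K3KugaSatakeDescent.SerreTypeAnchor, both typing kills by prime-free sets); steered around — every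
prime set here is explicit ({1951, ℓ}, ℓ = 7 in closes, the 29 zeros), eve

History (route lifecycle, newest last):
- 2026-08-25T10:01:15Z · DORMANT — reconciler: no traction for 7.6 d (last activity item-evidence-added at 2026-08-17T19:10:44Z); parked, not closed — `ledger route dormant route-Langlands-Dedeki (operator:999:2551976)
- 2026-08-25T11:08:13Z · REACTIVATED — reconciler: reactivated — activity route-repaired at 2026-08-25T10:02:52Z after parking at 2026-08-25T10:01:15Z (operator:999:2911324)
- 2026-08-27T15:10:19Z · STALE-VERDICT (tier-A confirmation): L388: Application type mismatch: The argument   RD has type   Nonempty (ReciprocityData ℚ) of sort `Prop` but is expected to have type   ReciprocityData ℚ of so (operator:gate5)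

sub-problem: Langlands · status: open · opened planner-plan-novel-Langlands-Langlands-e266a39d-d-v2-g13-0 2026-08-17T01:39:02Z · rev 7 · ledger route-Langlands-DedekindQuotient1951
GENERATED by the gate from the ledger (D-0016/17). Provers cite these decls: `theorem foo : Summit.Langlands.Langlands.Theses.DedekindQuotient1951.<Decl> := …` in Summits/Langlands/Langlands/Theorems/<Name>.lean.
-/

namespace Summit.Langlands.Langlands.Theses.DedekindQuotient1951

open scoped BigOperators Topology Manifold Classical MeasureTheory ProbabilityTheory Matrix InnerProductSpace ComplexConjugate ContinuousMap
open Filter Set Function TopologicalSpace MeasureTheory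

attribute [summit_statement] _root_.Langlands

/-- item stmt-Langlands-17270 · crux · rank 2 · open · by planner
why it might fail: Langlands (indeed Artin) is true: ζ_K(ρ_ζ) = 0 exactly at every zero of ζ and the two auxiliary L-functions are generically non-zero there, so the certified ledger refutes C1 (the non-rigorous PARI value at the first zeros is the cheapest indication).
sources: Booker2006, Booker2003, DoudMoore2006, arXiv:1610.01228, zbl:0298.12003, zbl:1044.11099
[crux] [computational bet] for every number field K = ℚ(θ) generated by a root θ of x⁵ − x⁴ − 780x³
+ 9911x² − 24208x + 15952 (the Doud–Moore totally real A₅ quintic, d_K = 1951⁴), the quotient ζ_K/ζ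
is NOT holomorphic on the box 0 < Re s, |Im s| < 100: there is no function g holomorphic on that box
with g(s)·ζ(s) = ζ_K(s) for Re s > 1, |Im s| < 100. Settled by ONE kit job: Arb-certified evaluation
(smoothed approximate functional equation, Booker2006 §5 / Turing §4) of ζ_K (degree 5, N = 1951⁴),
L(s,χ₃,K) = L(ρ₅) (degree 5, N = 1951⁴) and L(s,χ₂,K₆) = L(ρ₃)L(ρ₃') (degree 6, N = 1951⁴) on small
discs around the 29 zeros of ζ with 0 < Im < 100; TRUE-certificate = a zero ρ_ζ with |ζ_K(ρ_ζ)| >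
error (pole of ζ_K/ζ) ⇒ with C2, C3, S4: ¬Langlands; FALSE-certificate = at every such disc the two
auxiliary Hecke L-functions do not vanish (Booker's almost-monomial consistency for A₅: then ord
L(ρ₄) ≥ 0 pointwise) ⇒ route closes refuted:QuinticDedekindPole with the first certified
verification of Artin/Dedekind holomorphy for a totally real A₅ field as evidence. [difficulty: L] -/
@[route_item "route-Langlands-DedekindQuotient1951", crux (bottleneck := work) (experiment := "instrument: udMoorePermutationSupply_proof`, 17273 `…Theorems.DedekindQuotient1951.PartialLEntire_proof`, 17271 `…Theorems.DedekindQuotientEntire_of`; …") (source := "director LANGLANDS l.27, 2026-09-01")]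
def QuinticDedekindPole : Prop :=
  ∀ (K : Type) [Field K] [NumberField K] (θ : K), θ ^ 5 - θ ^ 4 - 780 * θ ^ 3 + 9911 * θ ^ 2 - 24208 * θ + 15952 = 0 → IntermediateField.adjoin ℚ ({θ} : Set K) = ⊤ → ¬ ∃ g : ℂ → ℂ, DifferentiableOn ℂ g {s : ℂ | 0 < s.re ∧ |s.im| < 100} ∧ ∀ s : ℂ, 1 < s.re → |s.im| < 100 → g s * riemannZeta s = NumberField.dedekindZeta K s

/-- item stmt-Langlands-17271 · crux · rank 3 · closed · proved by Summit.Langlands.Langlands.Theorems.DedekindQuotientEntire_of (prover) · by planner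
why it might fail: as TYPED: the summit-model π reaches Godement–Jacquet only via the Borel–Jacquet dictionary; a normalisation slip (q^s-shift of Satake parameters, arithmetic vs geometric Frobenius) would break g·ζ = ζ_K by finitely many Euler factors.
sources: GodementJacquet1972, JacquetShalikaAJM1981, BorelJacquetCorvallis1979, HarrisTaylorAMS2001, BuzzardGeeLMS2014, NeukirchANT1999
[crux] [typed reciprocity ⇒ Dedekind's conjecture] Given the Godement–Jacquet input S4 (as
antecedent): for every number field K, reciprocity datum RD of ℚ, prime ℓ, ι : ℚ̄_ℓ ≃ ℂ, cuspidal
L-algebraic π of GL₄(𝔸_ℚ) and ρ : Γ_ℚ → GL₄(ℚ̄_ℓ) such that at every finite v with N v ∉ {1951, ℓ} ρ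
is unramified with Frobenius characteristic polynomial Q_v satisfying (X − 1)·Q_v = ∏_{𝔭 ∣ N v}
(X^{f(𝔭)} − 1) in 𝓞_K, if `Corresponds RD ι π ρ` (the summit's predicate: Satake matching a.e. AND
local–global compatibility at every finite place) then ζ_K/ζ is holomorphic on Re s > 0: there is g
holomorphic there with g·ζ = ζ_K on Re s > 1. Chain: the COFINITE Satake–Frobenius clause of
`Corresponds` alone (no local Langlands property needed; alternatively LGC at unramified v ∤ ℓ,
landed for all n as satakeFrobCompatibleAt_of_localGlobalCompatibleAt_away) + uniqueness of
Frobenius characteristic polynomials at unramified places ⇒ off a FINITE set T ⊇ {v : N v ∈ {1951,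
ℓ}} the Satake Euler polynomial at v is Q_v (root multiset stable under inversion, so the
arithmetic/geometric Frobenius dictionary is immaterial); S4 at n = 4 with S = T gives an entire g₀
equal to ∏_{p∉T} ζ_{K,p}(s)(1 − p^{-s}) far t -/
@[route_item "route-Langlands-DedekindQuotient1951", crux]
def DedekindQuotientEntire : Prop :=
  (∀ (n : ℕ), 2 ≤ n → ∀ (hcpt : Literature.NumberTheory.Automorphic.isCompact_glFiniteIntegralLevel n ℚ) (π : Literature.NumberTheory.Automorphic.CuspidalAutomorphicRepData n ℚ hcpt) (S : Set (IsDedekindDomain.HeightOneSpectrum (NumberField.RingOfIntegers ℚ))), S.Finite → ∀ α : IsDedekindDomain.HeightOneSpectrum (NumberField.RingOfIntegers ℚ) → Multiset ℂ, (∀ v, v ∉ S → π.1.HasSatakeParamAt v (α v)) → ∃ (σ₀ : ℝ) (g : ℂ → ℂ), Differentiable ℂ g ∧ ∀ s : ℂ, σ₀ < s.re → HasProd (fun v : {v : IsDedekindDomain.HeightOneSpectrum (NumberField.RingOfIntegers ℚ) // v ∉ S} => (((α v.1).map fun a : ℂ => 1 - a * ((v.1.residueCard : ℂ) ^ (-s))).prod)⁻¹)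 (g s)) → ∀ (K : Type) [Field K] [NumberField K] (RD : Summit.Langlands.ReciprocityData ℚ) (ℓ : ℕ) [Fact ℓ.Prime] (ι : PadicAlgCl ℓ ≃+* ℂ) (hcpt : Literature.NumberTheory.Automorphic.isCompact_glFiniteIntegralLevel 4 ℚ) (π : Literature.NumberTheory.Automorphic.CuspidalAutomorphicRepData 4 ℚ hcpt) (ρ : Literature.NumberTheory.GaloisRepresentations.FramedGaloisRep ℚ (PadicAlgCl ℓ) 4), (∀ v : IsDedekindDomain.HeightOneSpectrum (NumberField.RingOfIntegers ℚ), v.residueCard ≠ 1951 → v.residueCard ≠ ℓ → ρ.IsUnramifiedAt v ∧ ∃ Q : Polynomial (PadicAlgCl ℓ), ρ.HasFrobCharpolyAt v Q ∧ (Polynomial.X - Polynomial.C 1) * Q = (∏ 𝔭 ∈ (UniqueFactorizationMonoid.factors (Ideal.span {((v.residueCard : ℕ) : NumberField.RingOfIntegers K)})).toFinset, (Polynomial.X ^ (𝔭.inertiaDeg ℤ) - 1 : Polynomial ℤ)).map (Int.castRingHom (PadicAlgCl ℓ))) → π.1.IsLAlgebraic → Summit.Langlands.Corresponds RD ι π.1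 ρ → ∃ g : ℂ → ℂ, DifferentiableOn ℂ g {s : ℂ | 0 < s.re} ∧ ∀ s : ℂ, 1 < s.re → g s * riemannZeta s = NumberField.dedekindZeta K s

-- `DedekindQuotientEntire` holds: proved by `Summit.Langlands.Langlands.Theorems.DedekindQuotientEntire_of` (its module imports this route file, so no `_holds` link can be stated here).

/-- item stmt-Langlands-17272 · support · rank 9 · closed · proved by Summit.Langlands.Langlands.Theorems.DedekindQuotient1951.DoudMoorePermutationSupply_proof (prover) · by planner
sources: DoudMoore2006, NeukirchANT1999, JonesRoberts2008
[support] [Doud–Moore permutation supply, known in substance] for every reciprocity datum RD of ℚ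
and every prime ℓ ≠ 1951 there are ρ : Γ_ℚ → GL₄(ℚ̄_ℓ) irreducible and geometric in the summit's
sense, and the number field K = ℚ(θ) of a root of the Doud–Moore quintic (IntermediateField.adjoin ℚ
{θ} = ⊤), such that ρ is unramified at every v with N v ≠ 1951 with Frobenius characteristic
polynomial Q_v, (X − 1)·Q_v = ∏_{𝔭 ∣ N v} (X^{f(𝔭)} − 1). Witness: from the LANDED
stub_dmGaloisDatum / doudMooreField (roots θ : Fin 5 → ℤ̄, permutation datum e₀ : Γ_ℚ → S₅ with open
kernel, image A₅ containing a 5-cycle, unramified away from 1951): ρ = the permutation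
representation on the roots restricted to the sum-zero hyperplane, ℚ̄_ℓ-coefficients; irreducible
(4-dim irrep of A₅, characteristic 0); geometric via isGeometricFramed_of_unramified_away (ℓ ≠ 1951:
unramified ⇒ de Rham for every datum); the characteristic-polynomial identity is Dedekind's theorem
(cycle type of Frobenius on the roots = residue degrees of the primes above p in ℚ(θ), p
unramified), (X − 1)·charpoly(ρ(Frob)) = charpoly(perm(Frob)) = ∏_cycles (X^len − 1). [difficulty:
M] -/
@[route_item "route-Langlands-DedekindQuotient1951", crux]
def DoudMoorePermutationSupply : Prop :=
  ∀ (RD : Summit.Langlands.ReciprocityData ℚ) (ℓ : ℕ) [Fact ℓ.Prime], ℓ ≠ 1951 → ∃ (ρ : Literature.NumberTheory.GaloisRepresentations.FramedGaloisRep ℚ (PadicAlgCl ℓ) 4) (K : Type) (_ : Field K) (_ : NumberField K) (θ : K), θ ^ 5 - θ ^ 4 - 780 * θ ^ 3 + 9911 * θ ^ 2 - 24208 * θ + 15952 = 0 ∧ IntermediateField.adjoin ℚ ({θ} : Set K) = ⊤ ∧ ρ.toGaloisRep.IsIrreducible ∧ Summit.Langlands.IsGeometricFramed RD ρ ∧ ∀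 v : IsDedekindDomain.HeightOneSpectrum (NumberField.RingOfIntegers ℚ), v.residueCard ≠ 1951 → ρ.IsUnramifiedAt v ∧ ∃ Q : Polynomial (PadicAlgCl ℓ), ρ.HasFrobCharpolyAt v Q ∧ (Polynomial.X - Polynomial.C 1) * Q = (∏ 𝔭 ∈ (UniqueFactorizationMonoid.factors (Ideal.span {((v.residueCard : ℕ) : NumberField.RingOfIntegers K)})).toFinset, (Polynomial.X ^ (𝔭.inertiaDeg ℤ) - 1 : Polynomial ℤ)).map (Int.castRingHom (PadicAlgCl ℓ))

-- `DoudMoorePermutationSupply` holds: proved by `Summit.Langlands.Langlands.Theorems.DedekindQuotient1951.DoudMoorePermutationSupply_proof` (its module imports this route file, so no `_holds` link can be stated here).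

/-- item stmt-Langlands-17273 · support · rank 9 · closed · proved by Summit.Langlands.Langlands.Theorems.DedekindQuotient1951.PartialLEntire_proof (prover) · by planner
sources: GodementJacquet1972, JacquetShalikaAJM1981, BorelJacquetCorvallis1979
[support] [needs-fact, stated INLINE in the summit's model: Godement–Jacquet + Jacquet–Shalika + the
Borel–Jacquet dictionary] for every n ≥ 2, every cuspidal automorphic representation π of GL_n(𝔸_ℚ)
(CuspidalAutomorphicRepData), every finite set S of finite places and every family α of Satake
parameters of π off S (π.1.HasSatakeParamAt v (α v) for v ∉ S), the partial standard Euler product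
∏_{v∉S} ∏_{a∈α_v} (1 − a·N v^{-s})⁻¹ converges (HasProd) on some right half-plane Re s > σ₀ to the
values of an ENTIRE function. The day the Literature named fact `godementJacquet` (n ≥ 2: L(s,Π)
entire) is discharged together with the Borel–Jacquet dictionary facts (exists_isAssociatedL2,
hasSatakeParamAt_iff_L2, cuspidal_W'_eq_bot; bridge
CuspidalAutomorphicRepData.exists_satake_eq_cpow_mul_L2 is landed) this item closes in a few lines
(the q^s₀-shift only moves σ₀; the finitely many unramified factors inside S are entire);
Jacquet–Shalika absolute convergence is already unconditional in the tree
(AutomorphicLFunctionHolds). [difficulty: L] -/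
@[route_item "route-Langlands-DedekindQuotient1951", crux]
def PartialLEntire : Prop :=
  ∀ (n : ℕ), 2 ≤ n → ∀ (hcpt : Literature.NumberTheory.Automorphic.isCompact_glFiniteIntegralLevel n ℚ) (π : Literature.NumberTheory.Automorphic.CuspidalAutomorphicRepData n ℚ hcpt) (S : Set (IsDedekindDomain.HeightOneSpectrum (NumberField.RingOfIntegers ℚ))), S.Finite → ∀ α : IsDedekindDomain.HeightOneSpectrum (NumberField.RingOfIntegers ℚ) → Multiset ℂ, (∀ v, v ∉ S → π.1.HasSatakeParamAt v (α v)) → ∃ (σ₀ : ℝ) (g : ℂ → ℂ), Differentiable ℂ g ∧ ∀ s : ℂ, σ₀ < s.re → HasProd (fun v : {v : IsDedekindDomain.HeightOneSpectrum (NumberField.RingOfIntegers ℚ) // v ∉ S} => (((α v.1).map fun a : ℂ => 1 - a * ((v.1.residueCard : ℂ) ^ (-s))).prod)⁻¹) (g s)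

-- `PartialLEntire` holds: proved by `Summit.Langlands.Langlands.Theorems.DedekindQuotient1951.PartialLEntire_proof` (its module imports this route file, so no `_holds` link can be stated here).

/-- item stmt-Langlands-17274 · assembly · rank 1 · closed · proved by Summit.Langlands.Langlands.Theorems.dedekindQuotient1951_assembly_proof (prover) · by planner
sources: BuzzardGeeLMS2014, Booker2006, DoudMoore2006
[assembly] QuinticDedekindPole → DedekindQuotientEntire → DoudMoorePermutationSupply →
PartialLEntire → ¬ Langlands (the deciding theorem `closes` proves exactly this). -/
@[route_item "route-Langlands-DedekindQuotient1951"]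
def Assembly : Prop :=
  QuinticDedekindPole → DedekindQuotientEntire → DoudMoorePermutationSupply → PartialLEntire → ¬ _root_.Langlands

-- `Assembly` holds: proved by `Summit.Langlands.Langlands.Theorems.dedekindQuotient1951_assembly_proof` (its module imports this route file, so no `_holds` link can be stated here).

/-! D-0027 §2.1 — DECIDING THEOREM (planner-authored via `route open/edit --closes-file`; by planner-decomp-langlands-writer-1-g7-0 2026-08-31T08:12:39Z):
its hypotheses are this route's items and its conclusion the sub-problem Statement (glue_lint), and it elaborates with this file. -/

@[closes "route-Langlands-DedekindQuotient1951"] theorem closes (h₁ : QuinticDedekindPole) (h₂ : DedekindQuotientEntire)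
    (h₃ : DoudMoorePermutationSupply) (h₄ : PartialLEntire) : ¬ _root_.Langlands := by
  intro hL
  obtain ⟨⟨RD⟩, hRD⟩ := hL ℚ
  haveI : Fact (Nat.Prime 7) := ⟨by norm_num⟩
  obtain ⟨ρ, K, _, _, θ, hθ, hgen, hirr, hgeo, hfrob⟩ := h₃ RD 7 (by norm_num)
  obtain ⟨ι⟩ := PadicAlgCl.nonempty_ringEquiv_complex 7
  have hB := (hRD RD 4 (by norm_num)
    (Literature.NumberTheory.Automorphic.isCompact_glFiniteIntegralLevel_holds 4 ℚ)).2
  obtain ⟨π, hLalg, hcorr⟩ := hB 7 ι ρ hirr hgeo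
  obtain ⟨g, hg, hgeq⟩ :=
    h₂ h₄ K RD 7 ι _ π ρ (fun v hv _ => hfrob v hv) hLalg hcorr
  exact h₁ K θ hθ hgen ⟨g, hg.mono fun s hs => hs.1, fun s hs _ => hgeq s hs⟩

end Summit.Langlands.Langlands.Theses.DedekindQuotient1951
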